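import Summits.BirchSwinnertonDyer.Rank1Residual.X1.TamagawaSqueeze
import Summits.BirchSwinnertonDyer.Rank1Residual.X1.RankOneCongruenceTransfer
import Summits.BirchSwinnertonDyer.Rank1Residual.X1.RankOneCoefficientCertificate
import HarnessLib

/-!
# Route T at RANK ONE on class X1: a lower bound `λ_alg ≥ k` with `λ_an ≤ k + 1` and the ODD-parity
# squeeze ⇒ Mazur's main conjecture at a rank-one leaf pair; with the Schneider certificate ⇒ `BSD(E,p)`

HONEST FRAMING (cell `b2b-bsdres`, run/shared/lean/b2b/bsd-rank1-residual/, verbatim in every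
file): the goal of the cell is to DELETE the COMBINATION-SHAPED residual classes of the
Birch–Swinnerton-Dyer formula for ALL analytic-rank `≤ 1` elliptic curves over `ℚ` — "full BSD
formula for every rank `≤ 1` curve in class `C`" assembled STRICTLY from published theorems — so
that the rank-`≤ 1` remainder becomes exactly the CONSTRUCTION-SHAPED classes, which are TYPED
(missing-input `Prop`s), NOT attempted. This is not "finishing BSD". Unit `b2b-bsdres-x1a` (X1 prover
A; CLASS-OWNERS row "X1 (r = 1)"), gen 11: research route; NO CLAIM BEYOND STATED CLASSES; nothing
here changes a label; no new named fact, no new def (theorems only, over PUBLISHED named facts and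
eisenstein-p1's typed per-pair inputs `AlgebraicLambdaGE`, `AnalyticLambdaEq`, `AnalyticMuLE`/`MuPartAt`).

WHY THIS FILE. Sub-cell eisenstein-p1's route T (`X1/TamagawaSqueeze.lean`): ANY lower bound
`λ_alg(E,p) = λ(X(E/ℚ_∞)) ≥ k` (typed input `AlgebraicLambdaGE W p k`; supplied per pair OUTSIDE the
kernel by Greenberg's Cor. 5.6 mechanism over the cyclotomic layers — Tamagawa kernels, the anomalous
local kernel, torsion) with `λ_an ≤ k + 1` closes Mazur's main conjecture on the RANK-ZERO leaf by the
EVEN-parity squeeze (`λ(f_E)` even at Selmer corank `0`, Greenberg Prop. 3.10). The rank-one half was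
"not filed (not my class)" (X1R0-GAPMAP §13.3); x1b's `X1/RankOneParitySqueeze.lean` files the two
smallest rank-one cases with the LEADING-TERM formula in place of a λ-bound (`λ_an = 1`: no squeeze;
`λ_an = 3`: Perrin-Riou–Schneider excludes `λ(f_E) = 1` under the inequality `hb`). This file files the
general rank-one route T, the exact mirror of eisenstein-p1's §2–§3 at Selmer corank `1`:

* §1 `lambdaPartAt_of_algebraicLambdaGE_of_odd`: `λ(f_E) ≥ k` (input), `λ(f_E)` ODD (Prop. 3.10 at
  corank `1`), `λ(f_E·h) = λ_an = n` odd, `n ≤ k + 1` ⇒ `λ(h)` even and `≤ 1` ⇒ `0`: the λ-part;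
  `mazurMainConjecture_of_algebraicLambdaGE_of_odd` (+ the μ-part).
* §2 on the rank-one leaf `RankOne.Leaf` (BOTH Greenberg–Vatsal types): corank `1` by GZK
  (`RankOne.Leaf.selmerCorank_eq_one`, x1a `X1/RankOneCongruenceTransfer.lean`), `λ_an` odd automatically (x1b's
  `RankOne.Leaf.odd_of_analyticLambdaEq`): **`RankOne.Leaf.mazurMainConjecture_of_algebraicLambdaGE`**
  (`MuPartAt ∧ λ_an = n ∧ λ_alg ≥ k ∧ n ≤ k + 1 ⇒` Mazur's MC), `…_of_muZero_…` (μ-part automatic at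
  `μ_an = 0`); consistency `RankOne.Leaf.le_of_algebraicLambdaGE_of_analyticLambdaEq` (`k ≤ n`).
* §3 `BSD(E,p)`: + Schneider's non-degeneracy at the pair (x1a `RankOne.Leaf.bsdp_of_mazurMainConjecture_of_schneider`:
  Perrin-Riou–Schneider, Perrin-Riou 1987, Mazur–Tate `σ`, modularity, GZK — all PUBLISHED), in the
  three certificate currencies (`SchneiderConjecture` at THE canonical height; `[T¹]L_p(f,α) ≠ 0`;
  `p^{-v} ≤ ‖[T¹](ϖ·L_p(f,α))‖_p`). NO `#Ш(E/ℚ)_an` input. At `n = 3`, `k = 2` this is x1b's P₃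
  conclusion with the λ-bound in place of the inequality `hb`; the first case beyond P₁/P₃ is
  `λ_an = 5` with `λ_alg ≥ 4`.

What this is NOT: a class theorem (the bound, `λ_an` and the certificate are per pair; at rank one the
supplier's count must include the Mordell–Weil contribution — Greenberg Cor. 5.6's proof bounds
`corank Sel_E(ℚ_∞)^Γ` from `corank Sel_E(ℚ)_p = 1` plus the local kernels —, a recipe that lives outside
the kernel exactly as at rank `0`; no census of it exists yet at `r = 1` — a request to eisenstein-p1 /
iw-2 is filed with this gen's HANDOFF); a change of the class-level residue (X1-CHAIN §17b).

References: [GreenbergLNM1716] Lemma 3.2–3.4, Prop. 3.10, Cor. 5.6 (proof, p. 136); [Wuthrich2014]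
Thm. 16; [BalakrishnanMullerStein2015] Thm. 1.7; [PerrinRiou1987] §1.4 Cor. 1.8;
[MazurTateTeitelbaum1986Invent] §I.17–I.18; [SteinWuthrich2013] §§3–4, §9;
HOME/b2b-bsdres-eisenstein-p1/X1R0-GAPMAP.md §13.3, §14; HOME/b2b-bsdres-x1a/X1-CHAIN.md §20.
-/

noncomputable section

open scoped Classical MatrixGroups ModularForm

open PowerSeries CongruenceSubgroup WeierstrassCurve Literature.NumberTheory.EllipticCurves
  Literature.NumberTheory.EllipticCurves.ModularForms
  Literature.NumberTheory.EllipticCurves.Wuthrich2014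
  Literature.NumberTheory.EllipticCurves.Rank1Residual
  Literature.NumberTheory.EllipticCurves.Greenberg1999
  Summit.BirchSwinnertonDyer.BirchSwinnertonDyer.Theorems
  Summit.BirchSwinnertonDyer.BirchSwinnertonDyer.Theorems.Rank1ResidualX1Defs
  Summit.BirchSwinnertonDyer.Rank1Residual.X1.MuLambda
  Summit.BirchSwinnertonDyer.Rank1Residual.X1.MuPart
  Summit.BirchSwinnertonDyer.Rank1Residual.X1.ParitySqueeze
  Summit.BirchSwinnertonDyer.Rank1Residual.X1.TamagawaSqueeze
  Summit.BirchSwinnertonDyer.Rank1Residual.X1.RankOneCongruenceTransfer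

set_option autoImplicit false

namespace Summit.BirchSwinnertonDyer.Rank1Residual.X1.RankOneTamagawaSqueeze

/-! ## §1. Route T with the ODD-parity squeeze (Selmer corank `1`) -/

section Squeeze

variable {W : WeierstrassCurve ℚ} [W.IsElliptic] [W.IsGloballyMinimal] {p : ℕ} [Fact p.Prime]

/-- **Route T, λ-part with ODD parity (Selmer corank `1`).** `W/ℚ` globally minimal elliptic, `p ≠ 2`
good ordinary with `E[p]` reducible and `corank_{ℤ_p} Sel_{p^∞}(E/ℚ) = 1` (`hcork`); granted Wuthrich
2014 Thm. 16 (`hW16`) and Greenberg's Prop. 3.10 (`h310`), both PUBLISHED: if `λ_an(E,p) = n` is ODD,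
`λ_alg(E,p) ≥ k` (`AlgebraicLambdaGE W p k`) and `n ≤ k + 1`, then the λ-part `LambdaPartAt W p` holds:
`λ(f_E) = λ(X) ≥ k` is odd (Prop. 3.10 at corank `1`), `λ(f_E·h) = n` is odd, so `λ(h) = n − λ(f_E)` is
even and `≤ 1`, hence `0`. The rank-one twin of eisenstein-p1's `lambdaPartAt_of_algebraicLambdaGE_of_even`.
[cite: GreenbergLNM1716, Prop. 3.10 and Cor. 5.6 (proof, p. 136)] [cite: Wuthrich2014, Thm. 16 (p. 397)] -/
theorem lambdaPartAt_of_algebraicLambdaGE_of_odd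
    (hW16 : Wuthrich2014.charIdeal_dvd_padicLFunction)
    (h310 : prop310_selmerCorank_mod_two_eq_lambdaInvariant)
    (hp : p ≠ 2) (hgood : W.HasGoodReductionAtPrime p) (hord : ¬ (p : ℤ) ∣ W.frobeniusTrace p)
    (hred : ¬ W.HasIrreducibleModPGaloisRep p) (hcork : W.selmerCorank p = 1)
    {n k : ℕ} (hn : Odd n) (hlam : AnalyticLambdaEq W p n) (hk : AlgebraicLambdaGE W p k)
    (hnk : n ≤ k + 1) : LambdaPartAt W p := by
  intro κ γ hκ hγ hγ' _ f hf ϖ hϖ D g h hchar hι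
  haveI : Module.Finite (IwasawaAlgebra p) D.X := D.module_finite_holds hγ
  obtain ⟨hX, -⟩ := hW16 W p hp ⟨hgood, hord⟩ hred hκ hγ hγ' hf D ϖ hϖ
  have hgh : g * h ≠ 0 := mul_ne_zero_of_iota_eq hgood hord hf hϖ D hι
  have hg : g ≠ 0 := fun h0 ↦ hgh (by rw [h0, zero_mul])
  have hh : h ≠ 0 := fun h0 ↦ hgh (by rw [h0, mul_zero])
  have h1 : lam (g * h) = n := hlam f hf ϖ hϖ (g * h) hι
  have h2 : lam g = lambdaInvariant p D.X := lam_generator_eq_lambdaInvariant D.X hX hg hchar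
  have h3 : k ≤ lambdaInvariant p D.X := hk κ γ hκ hγ D hX
  have hodd : Odd (lam g) := by
    rw [h2]
    exact prop310_selmerCorank_mod_two_eq_lambdaInvariant.odd_lambdaInvariant_of_selmerCorank_eq_one
      h310 W p hp hκ hγ D hX hcork
  have hgh2 : Odd (lam (g * h)) := by rw [h1]; exact hn
  rw [lam_mul hg hh] at h1 hgh2 ⊢
  obtain ⟨a, ha⟩ := hodd
  obtain ⟨b, hb⟩ := hgh2
  omega

/-- **Route T with ODD parity: Mazur's main conjecture** from the μ-part (`MuPartAt W p`), `λ_an = n`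
odd, `λ_alg ≥ k`, `n ≤ k + 1`, at Selmer corank `1` (Wuthrich Thm. 16: `MC ⟺ μ-part ∧ λ-part`,
`X1/MuLambda.lean`). [cite: GreenbergLNM1716, Prop. 3.10 and Cor. 5.6 (proof, p. 136)]
[cite: Wuthrich2014, Thm. 16 (p. 397)] -/
theorem mazurMainConjecture_of_algebraicLambdaGE_of_odd
    (hW16 : Wuthrich2014.charIdeal_dvd_padicLFunction)
    (h310 : prop310_selmerCorank_mod_two_eq_lambdaInvariant)
    (hp : p ≠ 2) (hgood : W.HasGoodReductionAtPrime p) (hord : ¬ (p : ℤ) ∣ W.frobeniusTrace p)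
    (hred : ¬ W.HasIrreducibleModPGaloisRep p) (hcork : W.selmerCorank p = 1)
    (hμ : MuPartAt W p) {n k : ℕ} (hn : Odd n) (hlam : AnalyticLambdaEq W p n)
    (hk : AlgebraicLambdaGE W p k) (hnk : n ≤ k + 1) : MazurMainConjecture W p :=
  (mazurMainConjecture_iff_muPart_and_lambdaPart hW16 hp hgood hord hred).mpr
    ⟨hμ, lambdaPartAt_of_algebraicLambdaGE_of_odd hW16 h310 hp hgood hord hred hcork hn hlam hk hnk⟩

end Squeeze

/-! ## §2. On the rank-one leaf X1 ∩ {r = 1}: route T closes Mazur's main conjecture -/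

section Leaf

variable {W : WeierstrassCurve ℚ} [W.IsElliptic] [W.IsGloballyMinimal] {p : ℕ} [Fact p.Prime]

/-- **Route T on the rank-one leaf: Mazur's main conjecture** from `MuPartAt W p`, `λ_an = n`,
`λ_alg ≥ k` and `n ≤ k + 1` — parity automatic (`λ_an` odd: x1b's `RankOne.Leaf.odd_of_analyticLambdaEq`,
Mazur–Tate–Teitelbaum; `λ(f_E)` odd: Prop. 3.10 at corank `1`, GZK). Facts `hW16`, `h310`, `hmod`, `hGZK`
all PUBLISHED; either Greenberg–Vatsal type. [cite: GreenbergLNM1716, Prop. 3.10 and Cor. 5.6 (proof, p. 136)]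
[cite: Wuthrich2014, Thm. 16 (p. 397)] [cite: MazurTateTeitelbaum1986Invent, §I.17–I.18] -/
theorem _root_.Summit.BirchSwinnertonDyer.Rank1Residual.X1.RankOne.Leaf.mazurMainConjecture_of_algebraicLambdaGE
    (hW16 : Wuthrich2014.charIdeal_dvd_padicLFunction)
    (h310 : prop310_selmerCorank_mod_two_eq_lambdaInvariant)
    (hmod : nonempty_modularParametrizationData)
    (hGZK : rank_eq_analyticRank_of_analyticRank_le_one) (hL : RankOne.Leaf W p)
    (hμ : MuPartAt W p) {n k : ℕ} (hlam : AnalyticLambdaEq W p n) (hk : AlgebraicLambdaGE W p k)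
    (hnk : n ≤ k + 1) : MazurMainConjecture W p :=
  have hX := isClassX1_of_classX1 hL.1
  mazurMainConjecture_of_algebraicLambdaGE_of_odd hW16 h310 hX.two_ne hX.hasGoodReductionAtPrime
    hX.not_dvd_frobeniusTrace hX.not_hasIrreducibleModPGaloisRep (hL.selmerCorank_eq_one hGZK) hμ
    (hL.odd_of_analyticLambdaEq hW16 hmod hlam) hlam hk hnk

/-- **Route T on the rank-one leaf at a `μ = 0` member: `μ_an = 0 ∧ λ_an = n ∧ λ_alg ≥ k ∧ n ≤ k + 1 ⇒`
Mazur's main conjecture** (μ-part automatic, `MuPart.muPartAt_of_analyticMuLE_zero`).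
[cite: GreenbergLNM1716, Prop. 3.10 and Cor. 5.6 (proof, p. 136)] [cite: Wuthrich2014, Thm. 16 (p. 397)] -/
theorem _root_.Summit.BirchSwinnertonDyer.Rank1Residual.X1.RankOne.Leaf.mazurMainConjecture_of_muZero_of_algebraicLambdaGE
    (hW16 : Wuthrich2014.charIdeal_dvd_padicLFunction)
    (h310 : prop310_selmerCorank_mod_two_eq_lambdaInvariant)
    (hmod : nonempty_modularParametrizationData)
    (hGZK : rank_eq_analyticRank_of_analyticRank_le_one) (hL : RankOne.Leaf W p)
    (hμ0 : AnalyticMuLE W p 0) {n k : ℕ} (hlam : AnalyticLambdaEq W p n)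
    (hk : AlgebraicLambdaGE W p k) (hnk : n ≤ k + 1) : MazurMainConjecture W p :=
  have hX := isClassX1_of_classX1 hL.1
  hL.mazurMainConjecture_of_algebraicLambdaGE hW16 h310 hmod hGZK
    (muPartAt_of_analyticMuLE_zero hW16 hX.two_ne hX.hasGoodReductionAtPrime hX.not_dvd_frobeniusTrace
      hX.not_hasIrreducibleModPGaloisRep hμ0) hlam hk hnk

/-- **Consistency on the rank-one leaf (Kato–Wuthrich direction): a certified lower bound never exceeds
`λ_an`**, `k ≤ n` — the rank-one copy of eisenstein-p1's `Leaf.le_of_algebraicLambdaGE_of_analyticLambdaEq`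
(the data exist; `ϖ·L_p = ι(f_E·h)` gives `n = λ(f_E) + λ(h) ≥ λ(f_E) = λ(X) ≥ k`).
[cite: Wuthrich2014, Thm. 16 (p. 397)] -/
theorem _root_.Summit.BirchSwinnertonDyer.Rank1Residual.X1.RankOne.Leaf.le_of_algebraicLambdaGE_of_analyticLambdaEq
    (hW16 : Wuthrich2014.charIdeal_dvd_padicLFunction) (hmod : nonempty_modularParametrizationData)
    (hL : RankOne.Leaf W p) {n k : ℕ} (hk : AlgebraicLambdaGE W p k) (hn : AnalyticLambdaEq W p n) :
    k ≤ n := by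
  have hX := isClassX1_of_classX1 hL.1
  haveI : NeZero (W.conductorNorm ℤ) := ⟨(W.conductorNorm_pos_holds).ne'⟩
  obtain ⟨κ, hκ, γ, hγ, hγ'⟩ := exists_isCyclotomic_isTopGenerator_isCyclotomicVariable_holds p
  obtain ⟨D⟩ := W.nonempty_selmerDualData_holds κ γ hγ
  haveI : Module.Finite (IwasawaAlgebra p) D.X := D.module_finite_holds hγ
  obtain ⟨hXt, f, ϖ, g, h, hf, hϖ, hchar, hι⟩ := isTorsion_and_exists_factorisation hW16 hmod
    hX.two_ne hX.hasGoodReductionAtPrime hX.not_dvd_frobeniusTrace hX.not_hasIrreducibleModPGaloisRep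
    hκ hγ hγ' D
  have hgh : g * h ≠ 0 :=
    mul_ne_zero_of_iota_eq hX.hasGoodReductionAtPrime hX.not_dvd_frobeniusTrace hf hϖ D hι
  have hg0 : g ≠ 0 := fun h0 ↦ hgh (by rw [h0, zero_mul])
  have hh0 : h ≠ 0 := fun h0 ↦ hgh (by rw [h0, mul_zero])
  have h1 : lam (g * h) = n := hn f hf ϖ hϖ (g * h) hι
  have h2 : lam g = lambdaInvariant p D.X := lam_generator_eq_lambdaInvariant D.X hXt hg0 hchar
  have h3 : k ≤ lambdaInvariant p D.X := hk κ γ hκ hγ D hXt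
  have h4 : lam g ≤ lam (g * h) := lam_le_lam_mul hg0 hh0
  omega

end Leaf

/-! ## §3. `BSD(E,p)` on the rank-one leaf: route T + the Schneider certificate — no `#Ш(E/ℚ)_an` -/

section BSD

variable {W : WeierstrassCurve ℚ} [W.IsElliptic] [W.IsGloballyMinimal] {p : ℕ} [Fact p.Prime]

/-- **Route T ⇒ Mazur's main conjecture ∧ `BSD(E,p)` on the rank-one leaf, modulo Schneider at the
pair** (`hSch`: THE canonical cyclotomic height is non-degenerate; x1a's
`RankOne.Leaf.bsdp_of_mazurMainConjecture_of_schneider` — Perrin-Riou–Schneider `hS`, Perrin-Riou 1987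
`hPR`, Mazur–Tate sigma `hMT`, modularity, GZK, all PUBLISHED). No `#Ш(E/ℚ)_an` input.
[cite: GreenbergLNM1716, Prop. 3.10 and Cor. 5.6 (proof, p. 136)] [cite: Wuthrich2014, Thm. 16 (p. 397)]
[cite: BalakrishnanMullerStein2015, Thm. 1.7] [cite: PerrinRiou1987, §1.4 Cor. 1.8] -/
theorem _root_.Summit.BirchSwinnertonDyer.Rank1Residual.X1.RankOne.Leaf.mazurMainConjecture_and_bsdp_of_algebraicLambdaGE_of_schneider
    (hW16 : Wuthrich2014.charIdeal_dvd_padicLFunction)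
    (h310 : prop310_selmerCorank_mod_two_eq_lambdaInvariant)
    (hS : Schneider1985_order_charGenerator_odd) (hPR : perrinRiou_rankOne_leadingTerms_odd)
    (hMT : mazur_tate_sigma_exists_odd) (hmod : nonempty_modularParametrizationData)
    (hGZK : rank_eq_analyticRank_of_analyticRank_le_one) (hL : RankOne.Leaf W p)
    (hμ : MuPartAt W p) {n k : ℕ} (hlam : AnalyticLambdaEq W p n) (hk : AlgebraicLambdaGE W p k)
    (hnk : n ≤ k + 1) (hSch : ∀ Dh : PAdicHeightData W p, Dh.IsCanonical → SchneiderConjecture Dh) :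
    MazurMainConjecture W p ∧ BSDp W p :=
  have hMC : MazurMainConjecture W p :=
    hL.mazurMainConjecture_of_algebraicLambdaGE hW16 h310 hmod hGZK hμ hlam hk hnk
  ⟨hMC, hL.bsdp_of_mazurMainConjecture_of_schneider hS hPR hMT hmod hGZK hSch hMC⟩

/-- **Route T in certificate currency: `MuPartAt ∧ λ_an = n ∧ λ_alg ≥ k ∧ n ≤ k + 1` + `[T¹]L_p(f,α,T) ≠ 0`
(for SOME newform `f` of `E`) ⇒ Mazur's MC ∧ `BSD(E,p)`** on the rank-one leaf (converter
`RankOne.Leaf.schneider_of_coeff_one_ne_zero`, Perrin-Riou 1987 + GZK). No `#Ш_an`, no height computation.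
[cite: GreenbergLNM1716, Prop. 3.10 and Cor. 5.6 (proof, p. 136)] [cite: Wuthrich2014, Thm. 16 (p. 397)]
[cite: PerrinRiou1987, §1.4 Cor. 1.8] [cite: SteinWuthrich2013, §§3–4, §9] -/
theorem _root_.Summit.BirchSwinnertonDyer.Rank1Residual.X1.RankOne.Leaf.mazurMainConjecture_and_bsdp_of_algebraicLambdaGE_of_coeff_one_ne_zero
    (hW16 : Wuthrich2014.charIdeal_dvd_padicLFunction)
    (h310 : prop310_selmerCorank_mod_two_eq_lambdaInvariant)
    (hS : Schneider1985_order_charGenerator_odd) (hPR : perrinRiou_rankOne_leadingTerms_odd)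
    (hMT : mazur_tate_sigma_exists_odd) (hmod : nonempty_modularParametrizationData)
    (hGZK : rank_eq_analyticRank_of_analyticRank_le_one) (hL : RankOne.Leaf W p)
    (hμ : MuPartAt W p) {n k : ℕ} (hlam : AnalyticLambdaEq W p n) (hk : AlgebraicLambdaGE W p k)
    (hnk : n ≤ k + 1) {N : ℕ} [NeZero N] (f : CuspForm (Gamma0 N) 2) (hf : IsNewformOf W f)
    (hcoeff : coeff 1 (padicLFunction f (unitRoot W p : ℚ_[p])) ≠ 0) :
    MazurMainConjecture W p ∧ BSDp W p :=
  hL.mazurMainConjecture_and_bsdp_of_algebraicLambdaGE_of_schneider hW16 h310 hS hPR hMT hmod hGZK hμ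
    hlam hk hnk (hL.schneider_of_coeff_one_ne_zero hPR hGZK f hf hcoeff)

/-- **Route T, headline at a `μ = 0` member in the finite-precision currency a modular-symbol engine
certifies: `μ_an = 0 ∧ λ_an = n ∧ λ_alg ≥ k ∧ n ≤ k + 1` + `p^{-v} ≤ ‖[T¹](ϖ·L_p(f,α))‖_p` ⇒ Mazur's
MC ∧ `BSD(E,p)`** on the rank-one leaf (x1a `RankOne.coeff_one_ne_zero_of_le_norm_coeff_one_smul`). The
first case beyond x1b's P₁/P₃ is `n = 5`, `k = 4`. No `#Ш_an`.
[cite: GreenbergLNM1716, Prop. 3.10 and Cor. 5.6 (proof, p. 136)] [cite: Wuthrich2014, Thm. 16 (p. 397)]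
[cite: PerrinRiou1987, §1.4 Cor. 1.8] [cite: SteinWuthrich2013, §§3–4, §9] -/
theorem _root_.Summit.BirchSwinnertonDyer.Rank1Residual.X1.RankOne.Leaf.mazurMainConjecture_and_bsdp_of_muZero_of_algebraicLambdaGE_of_le_norm_coeff_one
    (hW16 : Wuthrich2014.charIdeal_dvd_padicLFunction)
    (h310 : prop310_selmerCorank_mod_two_eq_lambdaInvariant)
    (hS : Schneider1985_order_charGenerator_odd) (hPR : perrinRiou_rankOne_leadingTerms_odd)
    (hMT : mazur_tate_sigma_exists_odd) (hmod : nonempty_modularParametrizationData)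
    (hGZK : rank_eq_analyticRank_of_analyticRank_le_one) (hL : RankOne.Leaf W p)
    (hμ0 : AnalyticMuLE W p 0) {n k : ℕ} (hlam : AnalyticLambdaEq W p n) (hk : AlgebraicLambdaGE W p k)
    (hnk : n ≤ k + 1) {N : ℕ} [NeZero N] (f : CuspForm (Gamma0 N) 2) (hf : IsNewformOf W f)
    (ϖ : ℚ_[p]) (v : ℕ)
    (hcoeff : (p : ℝ) ^ (-(v : ℤ)) ≤ ‖coeff 1 (C ϖ * padicLFunction f (unitRoot W p : ℚ_[p]))‖) :
    MazurMainConjecture W p ∧ BSDp W p :=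
  have hpP : p.Prime := Fact.out
  have hX := isClassX1_of_classX1 hL.1
  hL.mazurMainConjecture_and_bsdp_of_algebraicLambdaGE_of_coeff_one_ne_zero hW16 h310 hS hPR hMT hmod hGZK
    (muPartAt_of_analyticMuLE_zero hW16 hX.two_ne hX.hasGoodReductionAtPrime hX.not_dvd_frobeniusTrace
      hX.not_hasIrreducibleModPGaloisRep hμ0) hlam hk hnk f hf
    (RankOne.coeff_one_ne_zero_of_le_norm_coeff_one_smul _ ϖ (zpow_pos (by exact_mod_cast hpP.pos) _)
      hcoeff)

end BSD

end Summit.BirchSwinnertonDyer.Rank1Residual.X1.RankOneTamagawaSqueeze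

end
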